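import Summits.FinalStateConjecture.FinalStateConjecture.Theorems.NearExtremalKappaCapture.Negative.ExponentMonotonicity

/-!
# `NearExtremalKappaCapture` (crux stmt-FinalStateConjecture-10606, route PhaseMixingCapture):
# localisation at the extremal germ (negative-side support, cdisprove seat, cycle 2)

Companion to `ExponentMonotonicity.lean` (p73006) and `SubextremalRedundancy.lean` (p74448).
Nothing here closes the crux; everything is `sorry`-free over the companion's `CaptureWith`.

`PlainCaptureOn s δ k a₁ a₂` is the body of the crux on the compact spin range `a₁M ≤ |a| ≤ a₂M`
with PLAIN constants (basin `ε(M)`, modulus `C(M)√dist`) — the shape of `BulkKerrCapture`.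
`captureWith_plainOn`: κ-capture ⇒ plain capture on every compact range (`a₂ < 1`).
`captureWith_of_plainOn_of_tail`: plain capture on `[a₁M, a₂M]` + κ-capture on the tail
`a₂M ≤ |a| < M` ⇒ κ-capture from `a₁` (`γ, p ≥ 0`). Hence `captureWith_iff_tail`, and
`near_iff_germ`: granted plain capture on compact ranges (`BulkPlainCapture`),
`NearExtremalKappaCapture ↔ ∀ a₂ < 1, ∃ N, CaptureWith N N 0 N N a₂`; `not_near_iff_germ`: a
counterexample family must accumulate at `|a| = M` and defeat every exponent there. Reading: the
crux is a statement about the punctured neighbourhoods of extremality in the Kerr family — the RATE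
of degeneration of basin and modulus — and nothing else; no fixed sub-extremal spin refutes it
without refuting bulk Kerr stability (Hintz arXiv:2606.28253, Thm. 1.1, at fixed spin).

The companion `TruncationTraps.lean` treats the low-exponent corners (`γ <` trap order). §8 at the
end (`captureWith_of_linear`): a Lipschitz modulus `C·dist` without κ-factor implies the typed
`√dist`-modulus with the NEGATIVE exponent `p = −γ/2` — `p ≤ 0` is admissible.
-/

noncomputable section

set_option linter.dupNamespace false

namespace Summit.FinalStateConjecture.FinalStateConjecture.Theorems.NearExtremalKappaCapture.Negative

open Literature.Geometry.Lorentzian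
open scoped Manifold ContDiff Topology ENNReal
open Set Filter

/-! ## §5  Localisation at the extremal germ -/

/-- **Plain-constant capture on the compact spin range `a₁ M ≤ |a| ≤ a₂ M`**: the body of the crux
with basin `ε(M)` and modulus `C(M)√dist` carrying NO κ-factor — the shape of `BulkKerrCapture`
(and of Hintz's fixed-spin theorem, arXiv:2606.28253 Thm 1.1, on paper) at fixed exponents. -/
def PlainCaptureOn [Kerr.Facts] [Kerr.SliceFacts] (s : ℕ) (δ : ℝ) (k : ℕ) (a₁ a₂ : ℝ) : Prop :=
  ∀ (M : ℝ) (hM : 0 < M), ∃ ε > (0 : ℝ), ∃ C : ℝ, ∀ a : ℝ, a₁ * M ≤ |a| → |a| ≤ a₂ * M →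
    Kerr.IsSubextremal M a →
      ∀ (D : InitialDataSet 𝓘(ℝ, E3) (Kerr.slice a M)) [D.metric.HasLeviCivita],
        D.IsVacuumConstraintSolution →
          InitialDataSet.dataWeightedSobolevEDist s δ D (Kerr.data M a M hM.le) <
              ENNReal.ofReal ε →
            ∀ 𝒟 : VacuumCauchyDevelopment D, 𝒟.IsMaximal →
              ∃ (M' a' : ℝ) (𝒟oc : Set 𝒟.carrier), Kerr.IsSubextremal M' a' ∧ FarComplete 𝒟 ∧
                𝒟.toSpacetime.ConvergesToKerr 𝒟oc M' a' k ∧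
                  |M' - M| + |a' - a| ≤ C *
                    √(InitialDataSet.dataWeightedSobolevEDist s δ D (Kerr.data M a M hM.le)).toReal

/-- On `|a| ≤ a₂ M` (`M > 0`) the κ-parameter is bounded below: `1 − a₂² ≤ 1 − (a/M)²`. -/
theorem kappaSq_ge_of_le {M a a₂ : ℝ} (hM : 0 < M) (ha : |a| ≤ a₂ * M) :
    1 - a₂ ^ 2 ≤ 1 - (a / M) ^ 2 := by
  have h1 : |a / M| ≤ a₂ := by
    rw [abs_div, abs_of_pos hM, div_le_iff₀ hM]
    exact ha
  have h2 : (a / M) ^ 2 ≤ a₂ ^ 2 := by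
    rw [← sq_abs (a / M)]
    exact pow_le_pow_left₀ (abs_nonneg _) h1 2
  linarith

/-- **κ-capture ⇒ plain capture on every compact spin range.** If `CaptureWith s δ k γ p a₁` then
for every `a₂ < 1` plain-constant capture holds on `a₁M ≤ |a| ≤ a₂M`, with
`ε = c · min ((1 − b²)^γ) 1`, `C' = max C 0 · max ((1 − b²)^{-p}) 1`, `b = max a₂ 0`. The content
of the crux is therefore entirely in the tail `|a| → M`. -/
theorem captureWith_plainOn [Kerr.Facts] [Kerr.SliceFacts] {s : ℕ} {δ : ℝ} {k : ℕ} {γ p a₁ : ℝ}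
    (h : CaptureWith s δ k γ p a₁) {a₂ : ℝ} (ha₂ : a₂ < 1) : PlainCaptureOn s δ k a₁ a₂ := by
  intro M hM
  obtain ⟨c, hc, C, h⟩ := h M hM
  set b : ℝ := max a₂ 0 with hb
  have hb0 : 0 ≤ b := le_max_right _ _
  have hb1 : b < 1 := max_lt ha₂ one_pos
  have hxb : 0 < 1 - b ^ 2 := by nlinarith [hb0, hb1]
  have hxb1 : 1 - b ^ 2 ≤ 1 := by nlinarith [hb0]
  refine ⟨c * min ((1 - b ^ 2) ^ γ) 1, mul_pos hc (lt_min (Real.rpow_pos_of_pos hxb γ) one_pos),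
    max C 0 * max ((1 - b ^ 2) ^ (-p)) 1, fun a ha hab hsub D _ hvac hdist 𝒟 hmax ↦ ?_⟩
  obtain ⟨hx0, hx1⟩ := kappaSq_pos_le_one hsub
  have hab' : |a| ≤ b * M := hab.trans (mul_le_mul_of_nonneg_right (le_max_left _ _) hM.le)
  have hxge : 1 - b ^ 2 ≤ 1 - (a / M) ^ 2 := kappaSq_ge_of_le hM hab'
  -- the plain basin lies in the κ-basin
  have hmin : min ((1 - b ^ 2) ^ γ) 1 ≤ (1 - (a / M) ^ 2) ^ γ := by
    rcases le_or_gt 0 γ with hγ | hγ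
    · exact (min_le_left _ _).trans (Real.rpow_le_rpow hxb.le hxge hγ)
    · exact (min_le_right _ _).trans (Real.one_le_rpow_of_pos_of_le_one_of_nonpos hx0 hx1 hγ.le)
  have hdist' : InitialDataSet.dataWeightedSobolevEDist s δ D (Kerr.data M a M hM.le) <
      ENNReal.ofReal (c * (1 - (a / M) ^ 2) ^ γ) :=
    hdist.trans_le (ENNReal.ofReal_le_ofReal (mul_le_mul_of_nonneg_left hmin hc.le))
  obtain ⟨M', a', 𝒟oc, hsub', hfar, hconv, hmod⟩ := h a ha hsub D hvac hdist' 𝒟 hmax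
  refine ⟨M', a', 𝒟oc, hsub', hfar, hconv, hmod.trans ?_⟩
  -- the κ-modulus is a plain modulus on the compact range
  have hmax' : (1 - (a / M) ^ 2) ^ (-p) ≤ max ((1 - b ^ 2) ^ (-p)) 1 := by
    rcases le_or_gt 0 p with hp | hp
    · exact (Real.rpow_le_rpow_of_nonpos hxb hxge (neg_nonpos.mpr hp)).trans (le_max_left _ _)
    · exact (Real.rpow_le_one hx0.le hx1 (by linarith)).trans (le_max_right _ _)
  have hpow0 : 0 ≤ (1 - (a / M) ^ 2) ^ (-p) := Real.rpow_nonneg hx0.le _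
  set d := √(InitialDataSet.dataWeightedSobolevEDist s δ D (Kerr.data M a M hM.le)).toReal
  have hd : 0 ≤ d := Real.sqrt_nonneg _
  calc C * (1 - (a / M) ^ 2) ^ (-p) * d ≤ max C 0 * (1 - (a / M) ^ 2) ^ (-p) * d :=
        mul_le_mul_of_nonneg_right (mul_le_mul_of_nonneg_right (le_max_left _ _) hpow0) hd
    _ ≤ max C 0 * max ((1 - b ^ 2) ^ (-p)) 1 * d :=
        mul_le_mul_of_nonneg_right (mul_le_mul_of_nonneg_left hmax' (le_max_right _ _)) hd

/-- **Plain capture on `[a₁M, a₂M]` + κ-capture on the tail `a₂M ≤ |a| < M` ⇒ κ-capture from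
`a₁`** (`γ, p ≥ 0`; constants `min c ε`, `max (max C₁ C₂) 0`). -/
theorem captureWith_of_plainOn_of_tail [Kerr.Facts] [Kerr.SliceFacts] {s : ℕ} {δ : ℝ} {k : ℕ}
    {γ p a₁ a₂ : ℝ} (h₁ : PlainCaptureOn s δ k a₁ a₂) (h₂ : CaptureWith s δ k γ p a₂)
    (hγ : 0 ≤ γ) (hp : 0 ≤ p) : CaptureWith s δ k γ p a₁ := by
  intro M hM
  obtain ⟨ε, hε, C₁, h₁⟩ := h₁ M hM
  obtain ⟨c, hc, C₂, h₂⟩ := h₂ M hM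
  refine ⟨min c ε, lt_min hc hε, max (max C₁ C₂) 0, fun a ha hsub D _ hvac hdist 𝒟 hmax ↦ ?_⟩
  obtain ⟨hx0, hx1⟩ := kappaSq_pos_le_one hsub
  have hxγ : (1 - (a / M) ^ 2) ^ γ ≤ 1 := Real.rpow_le_one hx0.le hx1 hγ
  have hxγ0 : 0 ≤ (1 - (a / M) ^ 2) ^ γ := Real.rpow_nonneg hx0.le _
  have hxp : 1 ≤ (1 - (a / M) ^ 2) ^ (-p) :=
    Real.one_le_rpow_of_pos_of_le_one_of_nonpos hx0 hx1 (neg_nonpos.mpr hp)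
  set d := √(InitialDataSet.dataWeightedSobolevEDist s δ D (Kerr.data M a M hM.le)).toReal
    with hd_def
  have hd : 0 ≤ d := Real.sqrt_nonneg _
  have hC0 : 0 ≤ max (max C₁ C₂) 0 := le_max_right _ _
  rcases le_or_gt |a| (a₂ * M) with hle | hlt
  · -- bulk range: use plain capture
    have hdist' : InitialDataSet.dataWeightedSobolevEDist s δ D (Kerr.data M a M hM.le) <
        ENNReal.ofReal ε := by
      refine hdist.trans_le (ENNReal.ofReal_le_ofReal ?_)
      calc min c ε * (1 - (a / M) ^ 2) ^ γ ≤ ε * (1 - (a / M) ^ 2) ^ γ :=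
            mul_le_mul_of_nonneg_right (min_le_right _ _) hxγ0
        _ ≤ ε * 1 := mul_le_mul_of_nonneg_left hxγ hε.le
        _ = ε := mul_one ε
    obtain ⟨M', a', 𝒟oc, hsub', hfar, hconv, hmod⟩ := h₁ a ha hle hsub D hvac hdist' 𝒟 hmax
    refine ⟨M', a', 𝒟oc, hsub', hfar, hconv, hmod.trans ?_⟩
    calc C₁ * d ≤ max (max C₁ C₂) 0 * d :=
          mul_le_mul_of_nonneg_right ((le_max_left _ _).trans (le_max_left _ _)) hd
      _ = max (max C₁ C₂) 0 * 1 * d := by ring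
      _ ≤ max (max C₁ C₂) 0 * (1 - (a / M) ^ 2) ^ (-p) * d :=
          mul_le_mul_of_nonneg_right (mul_le_mul_of_nonneg_left hxp hC0) hd
  · -- tail: use κ-capture from a₂
    have hdist' : InitialDataSet.dataWeightedSobolevEDist s δ D (Kerr.data M a M hM.le) <
        ENNReal.ofReal (c * (1 - (a / M) ^ 2) ^ γ) :=
      hdist.trans_le (ENNReal.ofReal_le_ofReal (mul_le_mul_of_nonneg_right (min_le_left _ _) hxγ0))
    obtain ⟨M', a', 𝒟oc, hsub', hfar, hconv, hmod⟩ := h₂ a hlt.le hsub D hvac hdist' 𝒟 hmax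
    refine ⟨M', a', 𝒟oc, hsub', hfar, hconv, hmod.trans ?_⟩
    have hpow0 : 0 ≤ (1 - (a / M) ^ 2) ^ (-p) := Real.rpow_nonneg hx0.le _
    exact mul_le_mul_of_nonneg_right
      (mul_le_mul_of_nonneg_right ((le_max_right _ _).trans (le_max_left _ _)) hpow0) hd

/-- **The tail decides.** Granted plain capture on `[a₁M, a₂M]` (`a₁ ≤ a₂`, `γ, p ≥ 0`),
κ-capture from `a₁` and from `a₂` are equivalent. -/
theorem captureWith_iff_tail [Kerr.Facts] [Kerr.SliceFacts] {s : ℕ} {δ : ℝ} {k : ℕ}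
    {γ p a₁ a₂ : ℝ} (hplain : PlainCaptureOn s δ k a₁ a₂) (h12 : a₁ ≤ a₂) (hγ : 0 ≤ γ)
    (hp : 0 ≤ p) : CaptureWith s δ k γ p a₁ ↔ CaptureWith s δ k γ p a₂ :=
  ⟨fun h ↦ captureWith_mono h le_rfl le_rfl le_rfl le_rfl le_rfl h12,
    fun h ↦ captureWith_of_plainOn_of_tail hplain h hγ hp⟩

/-- Plain capture is monotone in the exponents (`s, δ` up, `k` down) and in the range (shrinking
`[a₁, a₂]`). -/
theorem plainCaptureOn_mono [Kerr.Facts] [Kerr.SliceFacts] {s s' : ℕ} {δ δ' : ℝ} {k k' : ℕ}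
    {a₁ a₁' a₂ a₂' : ℝ} (h : PlainCaptureOn s δ k a₁ a₂) (hs : s ≤ s') (hδ : δ ≤ δ')
    (hk : k' ≤ k) (ha₁ : a₁ ≤ a₁') (ha₂ : a₂' ≤ a₂) : PlainCaptureOn s' δ' k' a₁' a₂' := by
  intro M hM
  obtain ⟨ε, hε, C, h⟩ := h M hM
  refine ⟨ε, hε, max C 0, fun a ha hab hsub D _ hvac hdist 𝒟 hmax ↦ ?_⟩
  have ha' : a₁ * M ≤ |a| := (mul_le_mul_of_nonneg_right ha₁ hM.le).trans ha
  have hab' : |a| ≤ a₂ * M := hab.trans (mul_le_mul_of_nonneg_right ha₂ hM.le)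
  have hle : InitialDataSet.dataWeightedSobolevEDist s δ D (Kerr.data M a M hM.le) ≤
      InitialDataSet.dataWeightedSobolevEDist s' δ' D (Kerr.data M a M hM.le) :=
    dataWeightedSobolevEDist_mono hs hδ _ _
  obtain ⟨M', a', 𝒟oc, hsub', hfar, hconv, hmod⟩ :=
    h a ha' hab' hsub D hvac (hle.trans_lt hdist) 𝒟 hmax
  refine ⟨M', a', 𝒟oc, hsub', hfar, Spacetime.ConvergesTo.of_le hconv hk, hmod.trans ?_⟩
  have hne : InitialDataSet.dataWeightedSobolevEDist s' δ' D (Kerr.data M a M hM.le) ≠ ⊤ :=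
    ne_top_of_lt hdist
  have hsqrt : √(InitialDataSet.dataWeightedSobolevEDist s δ D (Kerr.data M a M hM.le)).toReal ≤
      √(InitialDataSet.dataWeightedSobolevEDist s' δ' D (Kerr.data M a M hM.le)).toReal :=
    Real.sqrt_le_sqrt (ENNReal.toReal_mono hne hle)
  calc C * √(InitialDataSet.dataWeightedSobolevEDist s δ D (Kerr.data M a M hM.le)).toReal
      ≤ max C 0 * √(InitialDataSet.dataWeightedSobolevEDist s δ D (Kerr.data M a M hM.le)).toReal :=
        mul_le_mul_of_nonneg_right (le_max_left _ _) (Real.sqrt_nonneg _)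
    _ ≤ max C 0 * √(InitialDataSet.dataWeightedSobolevEDist s' δ' D
          (Kerr.data M a M hM.le)).toReal :=
        mul_le_mul_of_nonneg_left hsqrt (le_max_right _ _)

/-- **Bulk plain capture** (hypothesis): for every `a₂ < 1`, plain-constant capture of all spins
`|a| ≤ a₂ M` at SOME exponents `(s, δ, k)` — the content of `BulkKerrCapture` (crux #4 of the
route) and, on paper, of Hintz's theorem (arXiv:2606.28253, Thm 1.1: nonlinear stability at every
fixed sub-extremal spin; uniformity on compact spin sets by compactness of the argument's
constants, not stated there; Hintz arXiv:2606.28253, Thm. 1.1). -/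
def BulkPlainCapture [Kerr.Facts] [Kerr.SliceFacts] : Prop :=
  ∀ a₂ : ℝ, a₂ < 1 → ∃ (s : ℕ) (δ : ℝ) (k : ℕ), PlainCaptureOn s δ k 0 a₂

/-- A spin bound `a₁ ≤ 0` is no bound: `CaptureWith … a₁ ↔ CaptureWith … 0`. -/
theorem captureWith_iff_zero_of_nonpos [Kerr.Facts] [Kerr.SliceFacts] {s : ℕ} {δ : ℝ} {k : ℕ}
    {γ p a₁ : ℝ} (ha₁ : a₁ ≤ 0) : CaptureWith s δ k γ p a₁ ↔ CaptureWith s δ k γ p 0 := by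
  refine ⟨fun h ↦ captureWith_mono h le_rfl le_rfl le_rfl le_rfl le_rfl ha₁, fun h M hM ↦ ?_⟩
  obtain ⟨c, hc, C, h⟩ := h M hM
  exact ⟨c, hc, C, fun a _ hsub D _ hvac hdist 𝒟 hmax ↦
    h a (by simp) hsub D hvac hdist 𝒟 hmax⟩

/-- **Localisation at the extremal germ.** Granted bulk plain capture, `NearExtremalKappaCapture`
holds iff for EVERY `a₂ < 1` some diagonal exponent `N` captures the tail `a₂M ≤ |a| < M`: the
crux is a statement about the punctured neighbourhoods of `|a| = M` in the Kerr family, i.e. about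
the RATE of degeneration only. -/
theorem near_iff_germ [hF : Kerr.Facts] [hS : Kerr.SliceFacts] (hbulk : BulkPlainCapture) :
    Theses.PhaseMixingCapture.NearExtremalKappaCapture ↔
      ∀ a₂ : ℝ, a₂ < 1 → ∃ N : ℕ, CaptureWith N (N : ℝ) 0 (N : ℝ) (N : ℝ) a₂ := by
  rw [near_iff_diagonal]
  constructor
  · intro h a₂ ha₂
    obtain ⟨a₁, N, ha₁, hN⟩ := @h hF hS
    rcases le_or_gt a₁ a₂ with h12 | h21
    · exact ⟨N, captureWith_mono hN le_rfl le_rfl le_rfl le_rfl le_rfl h12⟩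
    · -- extend DOWN from `a₁` to `a₂` through the bulk range `[max a₂ 0, a₁]`
      obtain ⟨s, δ, k, hplain⟩ := hbulk a₁ ha₁
      set N' : ℕ := max N (max s ⌈δ⌉₊) with hN'
      have hNN' : N ≤ N' := le_max_left _ _
      have hsN' : s ≤ N' := by omega
      have hδN' : δ ≤ (N' : ℝ) :=
        (Nat.le_ceil δ).trans (by exact_mod_cast (by omega : ⌈δ⌉₊ ≤ N'))
      have hN'cap : CaptureWith N' (N' : ℝ) 0 (N' : ℝ) (N' : ℝ) a₁ :=
        captureWith_mono hN hNN' (by exact_mod_cast hNN') le_rfl (by exact_mod_cast hNN')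
          (by exact_mod_cast hNN') le_rfl
      have hplain' : PlainCaptureOn N' (N' : ℝ) 0 (max a₂ 0) a₁ :=
        plainCaptureOn_mono hplain hsN' hδN' (Nat.zero_le k) (le_max_right _ _) le_rfl
      have hcap : CaptureWith N' (N' : ℝ) 0 (N' : ℝ) (N' : ℝ) (max a₂ 0) :=
        captureWith_of_plainOn_of_tail hplain' hN'cap (Nat.cast_nonneg _) (Nat.cast_nonneg _)
      refine ⟨N', ?_⟩
      rcases le_or_gt a₂ 0 with h0 | h0
      · rw [captureWith_iff_zero_of_nonpos h0]
        rwa [max_eq_right h0] at hcap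
      · rwa [max_eq_left h0.le] at hcap
  · intro h _ _
    obtain ⟨N, hN⟩ := h 0 one_pos
    exact ⟨0, N, one_pos, by convert hN⟩

/-- **What a counterexample must look like.** Granted bulk plain capture, the crux FAILS iff for
some `a₂ < 1` — equivalently (monotonicity) for all `a₂` close enough to `1` — every diagonal
exponent `N` fails on the tail `a₂M ≤ |a| < M`: the obstruction accumulates at extremality and is
super-polynomial in `χ = 1 − a²/M²`. No fixed sub-extremal spin can refute the crux without
refuting bulk Kerr stability (`BulkPlainCapture`) itself. -/
theorem not_near_iff_germ [Kerr.Facts] [Kerr.SliceFacts] (hbulk : BulkPlainCapture) :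
    ¬ Theses.PhaseMixingCapture.NearExtremalKappaCapture ↔
      ∃ a₂ : ℝ, a₂ < 1 ∧ ∀ N : ℕ, ¬ CaptureWith N (N : ℝ) 0 (N : ℝ) (N : ℝ) a₂ := by
  rw [near_iff_germ hbulk]
  push Not
  rfl

/-! ## §8  The typed `√dist`-modulus is weaker than a Lipschitz final-parameter map -/

/-- Capture with a LINEAR (Lipschitz) modulus and NO κ-factor in it: the conclusion's last conjunct
reads `|M' − M| + |a' − a| ≤ C(M) · dist`. This is the modulus a `C¹` final-parameter map on a
uniform neighbourhood delivers (AKU arXiv:2603.10378, Conj. 1, p. 12: `C¹` isologous foliation;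
Thm 2–3 in the spherical model). -/
def LinearCaptureWith [Kerr.Facts] [Kerr.SliceFacts] (s : ℕ) (δ : ℝ) (k : ℕ) (γ a₁ : ℝ) : Prop :=
  ∀ (M : ℝ) (hM : 0 < M), ∃ c > (0 : ℝ), ∃ C : ℝ, ∀ a : ℝ, a₁ * M ≤ |a| →
    Kerr.IsSubextremal M a →
      ∀ (D : InitialDataSet 𝓘(ℝ, E3) (Kerr.slice a M)) [D.metric.HasLeviCivita],
        D.IsVacuumConstraintSolution →
          InitialDataSet.dataWeightedSobolevEDist s δ D (Kerr.data M a M hM.le) <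
              ENNReal.ofReal (c * (1 - (a / M) ^ 2) ^ γ) →
            ∀ 𝒟 : VacuumCauchyDevelopment D, 𝒟.IsMaximal →
              ∃ (M' a' : ℝ) (𝒟oc : Set 𝒟.carrier), Kerr.IsSubextremal M' a' ∧ FarComplete 𝒟 ∧
                𝒟.toSpacetime.ConvergesToKerr 𝒟oc M' a' k ∧
                  |M' - M| + |a' - a| ≤ C *
                    (InitialDataSet.dataWeightedSobolevEDist s δ D (Kerr.data M a M hM.le)).toReal

/-- **A Lipschitz modulus gives the crux's modulus with the NEGATIVE exponent `p = −γ/2`.** Inside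
the basin `dist < cχ^γ` one has `dist = √dist·√dist ≤ √c χ^{γ/2} √dist`, so
`C·dist ≤ (max C 0)√c · χ^{γ/2} · √dist`. Hence `LinearCaptureWith s δ k γ a₁ → CaptureWith s δ k γ
(−γ/2) a₁` (`γ ≥ 0` not even needed): the exponent `p` of the typed modulus may be taken `≤ 0`; it
measures nothing but the conversion between `dist` and `√dist` at the basin scale. With §2 this is
the route from AKU's Conjecture 1 (+ a Lipschitz final-parameter map, basin `cχ`) to the crux at
`(γ, p) = (1, −1/2)`. -/
theorem captureWith_of_linear [Kerr.Facts] [Kerr.SliceFacts] {s : ℕ} {δ : ℝ} {k : ℕ} {γ a₁ : ℝ}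
    (h : LinearCaptureWith s δ k γ a₁) : CaptureWith s δ k γ (-(γ / 2)) a₁ := by
  intro M hM
  obtain ⟨c, hc, C, h⟩ := h M hM
  refine ⟨c, hc, max C 0 * √c, fun a ha hsub D _ hvac hdist 𝒟 hmax ↦ ?_⟩
  obtain ⟨M', a', 𝒟oc, hsub', hfar, hconv, hmod⟩ := h a ha hsub D hvac hdist 𝒟 hmax
  refine ⟨M', a', 𝒟oc, hsub', hfar, hconv, hmod.trans ?_⟩
  obtain ⟨hx0, -⟩ := kappaSq_pos_le_one hsub
  set x : ℝ := 1 - (a / M) ^ 2 with hxdef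
  set d : ℝ := (InitialDataSet.dataWeightedSobolevEDist s δ D (Kerr.data M a M hM.le)).toReal
    with hddef
  have hd0 : 0 ≤ d := ENNReal.toReal_nonneg
  have hdlt : d < c * x ^ γ := ENNReal.toReal_lt_of_lt_ofReal hdist
  have hxg : 0 ≤ x ^ (γ / 2) := Real.rpow_nonneg hx0.le _
  have hsq : (√c * x ^ (γ / 2)) ^ 2 = c * x ^ γ := by
    rw [mul_pow, Real.sq_sqrt hc.le, ← Real.rpow_natCast (x ^ (γ / 2)) 2, ← Real.rpow_mul hx0.le]
    norm_num
  have hsqrt_d : √d ≤ √c * x ^ (γ / 2) := by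
    rw [← Real.sqrt_sq (mul_nonneg (Real.sqrt_nonneg _) hxg), hsq]
    exact Real.sqrt_le_sqrt hdlt.le
  have hdd : d = √d * √d := (Real.mul_self_sqrt hd0).symm
  have hC0 : 0 ≤ max C 0 := le_max_right _ _
  calc C * d ≤ max C 0 * d := mul_le_mul_of_nonneg_right (le_max_left _ _) hd0
    _ = max C 0 * (√d * √d) := by rw [← hdd]
    _ ≤ max C 0 * (√c * x ^ (γ / 2) * √d) :=
        mul_le_mul_of_nonneg_left (mul_le_mul_of_nonneg_right hsqrt_d (Real.sqrt_nonneg _)) hC0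
    _ = max C 0 * √c * x ^ (-(-(γ / 2))) * √d := by rw [neg_neg]; ring

end Summit.FinalStateConjecture.FinalStateConjecture.Theorems.NearExtremalKappaCapture.Negative

end
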